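import Literature.Barriers.PneNP.TSPExtensionComplexity
import Literature.Barriers.PneNP.TSPExtensionComplexityFaces
import Literature.Barriers.PneNP.ExtendedFormulationLinearImage
import Literature.Combinatorics.SimpleGraph.SubcubicMinors
import Literature.Combinatorics.Optimization.CorrelationPolytopeGridMinor
import HarnessLib

/-!
# Extension complexity of correlation polytopes is minor-monotone
# (Aboulker–Fiorini–Huynh–Macchia–Seif 2019, Observation 5) — proved

[topic Combinatorics/Optimization]

P. Aboulker, S. Fiorini, T. Huynh, M. Macchia, J. Seif, *Extension complexity of the correlation
polytope*, Oper. Res. Lett. 47 (2019) 47–51 = arXiv:1806.00541 [AboulkerEtAl2019] (held text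
`paper:arxiv-1806.00541`; `pNNNN Lk` = chunk/line of the lit-read materialisation), §2,
Observation 5 (p0005 L12–13): "If `H ≼ G`, then `xc(COR(H)) ≤ xc(COR(G))`."  In the tree's
extension-complexity currency (`Literature.Barriers.PneNP.HasEFOfSize P R`: "`P` is the projection
of a slack-form system with `R` sign-constrained variables") and over the rendering
`Literature.Combinatorics.Optimization.corPolytopeGraph G ⊆ ℝ^{V × V}` of `COR(G)` of
`CorrelationPolytopeGridMinor.lean` (vertex coordinate `x_v` at `(v,v)`, edge coordinate `x_{uv}` at
`(u,v)` and `(v,u)`, non-adjacent off-diagonal pairs masked to `0`) and the tree's minor relation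
`Literature.Combinatorics.SimpleGraph.IsMinor` (Diestel's branch sets), this file PROVES

* `hasEFOfSize_corPolytopeGraph_of_isMinor :
    IsMinor H G → HasEFOfSize (corPolytopeGraph G) R → HasEFOfSize (corPolytopeGraph H) R`
  (Observation 5, exactly: every size of an EF of `COR(G)` is a size of an EF of `COR(H)`);
* `AboulkerEtAl2019_obs5` — the same in the `∀`-packaged shape of `AvisTiwary2015_thm12`;
* `corPolytopeGraph_lowerBound_of_isMinor` — lower bounds `xc(COR(H)) ≥ B` ascend along minors;
* `AboulkerEtAl2019_corGridMinor_iff_grid` — the named fact `AboulkerEtAl2019_corGridMinor`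
  (grid minors force `xc(COR(G)) ≥ 2^{ch}`, NOT proved in the tree) is EQUIVALENT to its grid
  instance `xc(COR(G_{h,h})) ≥ 2^{ch}` (`AboulkerEtAl2019_corGridMinor.grid`); what remains of its
  printed proof is Theorem 6's grid-with-gadgets face construction on top of the tree's
  Kaibel–Weltge bound (`Literature/Barriers/PneNP/CorrelationPolytopeXCLowerBound.lean`).

No new definition, no named fact (net debt ±0).

## The printed proof and the one formalised

Printed proof (p0005 L15–18): "`H ≼ G` if and only if `H` can be obtained from `G` by deleting
edges, contracting edges, and removing isolated vertices. We show that none of these operations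
increases the extension complexity of the correlation polytope.  Let `uv ∈ E(G)`. Then
`COR(G ∖ uv)` can be obtained from `COR(G)` by projecting out `x_{uv}`. Moreover `COR(G / uv)` is
obtained from `COR(G)` by setting `x_u = x_{uv} = x_v` (this defines a face since `x_{uv} ≤ x_u` and
`x_{uv} ≤ x_v` are valid). If `w` is an isolated vertex of `G`, then `COR(G − w)` is obtained from
`COR(G)` by projecting out `x_w`."  with the folklore facts (p0005 L3) "If `A` is an affine subspace,
then `xc(P ∩ A) ≤ xc(P)`, and if `π` is an affine map, then `xc(π(P)) ≤ xc(P)`."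

As in the tree's proof of Avis–Tiwary's Theorem 12 (`CutPolytopeMinorMonotoneProofs.lean`, the
`CUT□` analogue), the tree's `IsMinor H G` — a partial map `φ : V(G) → Option V(H)` with non-empty
connected fibres (branch sets) and a `G`-edge between the branch sets of the ends of every edge of
`H` — packages a whole sequence of the three operations, so the printed single-step constructions
are applied SIMULTANEOUSLY:

* *the face* (all contractions at once): `F := COR(G) ∩ {x_{(a,a)} = x_{(a,b)} : ab ∈ E(G) inside a
  branch set}` (both orientations, so also `x_{(b,b)} = x_{(b,a)} = x_{(a,b)}` by symmetry of the
  rendering — the printed `x_u = x_{uv} = x_v`).  Each `x_{(a,a)} − x_{(a,b)} ≥ 0` is valid on the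
  `0/1` generators `corVec G s` (`𝟙[s a] ≥ 𝟙[s a ∧ s b]`, the printed "`x_{uv} ≤ x_u` is valid"), so
  `F` is the convex hull of the generators lying on it (`convexHull_inter_eq_of_valid`), and these
  are exactly the `s ∈ {0,1}^{V(G)}` that are constant on every branch set (along a walk inside a
  branch set `s` cannot change: `walk_const`, clause (ii) of `IsMinor`);
* *the projection* (all deletions at once, an honest linear map `L : ℝ^{V(G)×V(G)} → ℝ^{V(H)×V(H)}`):
  `(L x)_{(u,u)} = x_{(ρu, ρu)}` for a chosen representative vertex `ρu` of the branch set of `u`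
  (clause (i)), `(L x)_{(u,v)} = x_{(a,b)}` for a chosen representative `G`-edge `ab` between the
  branch sets of `u` and `v` when `uv ∈ E(H)` (clause (iii)), and `(L x)_{(u,v)} = 0` at the masked
  coordinates `u ≠ v`, `uv ∉ E(H)` — all other coordinates of `ℝ^{V(G)×V(G)}` (deleted edges, edges
  and vertices of unused parts, the duplicate coordinates inside a branch set) are dropped, which is
  the printed "projecting out";
* *vertices correspond*: `s' ∈ {0,1}^{V(H)}` lifts to `s := s' ∘ φ` (unused vertices `↦ 0`), which
  lies on `F` and has `L (corVec G s) = corVec H s'`; a generator `corVec G s` on `F` descends to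
  `s' u := s (ρu)` with the same identity (`desc_comp`), because `s` is constant on branch sets.
  Hence `COR(H) = L(F)` (`LinearMap.image_convexHull`);
* the two folklore facts in slack form, both LOSSLESS in the tree: `HasEFOfSize.inter_eqs`
  (`TSPExtensionComplexityFaces.lean`: appending equations is free) and
  `HasEFOfSize.image_linearMap` (`ExtendedFormulationLinearImage.lean`: linear images are free), so
  the printed inequality is obtained exactly, with no additive loss.

## References

* [AboulkerEtAl2019] P. Aboulker, S. Fiorini, T. Huynh, M. Macchia, J. Seif, *Extension complexity
  of the correlation polytope*, Oper. Res. Lett. 47 (2019) 47–51, doi:10.1016/j.orl.2018.12.001 =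
  arXiv:1806.00541; §1 (COR(G), minors: p0003 L3, L14), §2 folklore facts (p0005 L3), Obs. 5 and
  its proof (p0005 L12–18), Thm. 6 (p0005 L41–46) and its proof (p0005 L49 – p0006 L27).
  Read: held text, chunks p0003–p0006.
* [AvisTiwary2015] D. Avis, H. R. Tiwary, *On the extension complexity of combinatorial
  polytopes*, Math. Program. 153 (2015) 95–115 = arXiv:1302.2340, Props. 1–2, Lemmas 3–5, Thm. 12
  — the `CUT□` analogue whose tree proof (`AvisTiwary2015_thm12_holds`) this file follows.
* [Diestel2010] R. Diestel, *Graph Theory*, 4th ed., GTM 173 (2010), §1.7 — the tree's `IsMinor`.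
-/

noncomputable section

namespace Literature.Combinatorics.Optimization

open Finset SimpleGraph
open Literature.Barriers.PneNP (HasEFOfSize)
open Literature.Combinatorics.SimpleGraph (IsMinor)
open Literature.Computability.MetaComplexity (gridGraph)

/-- **Faces cut out by valid inequalities are spanned by the generators on them.**  For a finite
set `S ⊆ ℝ^ι` and linear forms `c_t` with `c_t · y ≥ 0` for all `y ∈ S` (valid homogeneous
inequalities), `conv(S) ∩ {x | c_t · x = 0 ∀ t} = conv {y ∈ S | c_t · y = 0 ∀ t}`: a convex
combination on the face puts no weight on generators off it.  This is the content of the printed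
"this defines a face since `x_{uv} ≤ x_u` and `x_{uv} ≤ x_v` are valid".
[cite: AboulkerEtAl2019, proof of Obs. 5 (arXiv:1806.00541 §2, p0005 L18)] [folklore] -/
theorem convexHull_inter_eq_of_valid {ι : Type} [Fintype ι] (S : Finset (ι → ℝ)) {T : Type}
    (c : T → ι → ℝ) (hS : ∀ y ∈ S, ∀ t, 0 ≤ c t ⬝ᵥ y) :
    convexHull ℝ (↑S : Set (ι → ℝ)) ∩ {x | ∀ t, c t ⬝ᵥ x = 0} =
      convexHull ℝ {y | y ∈ S ∧ ∀ t, c t ⬝ᵥ y = 0} := by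
  classical
  set S' : Finset (ι → ℝ) := S.filter fun y => ∀ t, c t ⬝ᵥ y = 0 with hS'def
  have hS' : {y | y ∈ S ∧ ∀ t, c t ⬝ᵥ y = 0} = (↑S' : Set (ι → ℝ)) := by
    ext y; simp [hS'def]
  rw [hS']
  have hsub : S' ⊆ S := Finset.filter_subset _ _
  apply Set.Subset.antisymm
  · rintro x ⟨hx, hxK⟩
    obtain ⟨w, hw0, hw1, hwx⟩ := Finset.mem_convexHull.1 hx
    have key : ∀ y ∈ S, y ∉ S' → w y = 0 := by
      intro y hy hyS'
      have hnot : ¬ ∀ t, c t ⬝ᵥ y = 0 := fun h => hyS' (Finset.mem_filter.2 ⟨hy, h⟩)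
      obtain ⟨t, hyt⟩ := not_forall.1 hnot
      have hxt : c t ⬝ᵥ x = ∑ y ∈ S, w y * (c t ⬝ᵥ y) := by
        rw [← hwx, Finset.centerMass_eq_of_sum_1 _ _ hw1, dotProduct_sum]
        refine Finset.sum_congr rfl fun y _ => ?_
        rw [id, dotProduct_smul, smul_eq_mul]
      have hsum0 : ∑ y ∈ S, w y * (c t ⬝ᵥ y) = 0 := by rw [← hxt]; exact hxK t
      have hterm := (Finset.sum_eq_zero_iff_of_nonneg (fun y hy =>
        mul_nonneg (hw0 y hy) (hS y hy t))).1 hsum0 _ hy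
      rcases mul_eq_zero.1 hterm with h | h
      · exact h
      · exact absurd h hyt
    refine Finset.mem_convexHull.2 ⟨w, fun y hy => hw0 y (hsub hy), ?_, ?_⟩
    · rw [Finset.sum_subset hsub key]; exact hw1
    · rw [Finset.centerMass_subset _ hsub key]; exact hwx
  · refine Set.subset_inter (convexHull_mono (Finset.coe_subset.2 hsub)) ?_
    refine convexHull_min ?_ ?_
    · intro y hy t
      exact (Finset.mem_filter.1 (Finset.mem_coe.1 hy)).2 t
    · intro x hx y hy a b _ _ _ t
      have hx' : c t ⬝ᵥ x = 0 := hx t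
      have hy' : c t ⬝ᵥ y = 0 := hy t
      rw [dotProduct_add, dotProduct_smul, dotProduct_smul, hx', hy', smul_zero, smul_zero, add_zero]

/-- The printed validity "`x_{uv} ≤ x_u`" on the generators: `𝟙[s a ∧ s b] ≤ 𝟙[s a]`, and equality
holds iff `s a → s b`. [cite: AboulkerEtAl2019, proof of Obs. 5 (p0005 L18)] -/
private theorem corVec_diag_eq_adj_iff {β : Type} [DecidableEq β] (G : SimpleGraph β)
    [DecidableRel G.Adj] (s : β → Bool) {a b : β} (hab : G.Adj a b) :
    (corVec G s (a, a) = corVec G s (a, b) ↔ (s a = true → s b = true)) ∧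
      0 ≤ corVec G s (a, a) - corVec G s (a, b) := by
  rw [corVec_apply_diag, corVec_apply_adj G s hab]
  cases s a <;> cases s b <;> simp

/-- **Aboulker–Fiorini–Huynh–Macchia–Seif 2019, Observation 5 — proved.**  For `H` a minor of `G`
(the tree's `IsMinor`: branch sets as fibres of a partial map `φ : V(G) → Option V(H)`), every
slack-form extended formulation of `COR(G)` with `R` sign-constrained variables yields one of
`COR(H)` with `R` sign-constrained variables: `xc(COR(H)) ≤ xc(COR(G))`.  Proof = the printed one,
all deletions / contractions at once: `COR(H)` is the image under an explicit linear map (keep one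
representative vertex coordinate per branch set and one representative edge coordinate per edge of
`H`, zero at masked pairs) of the face `COR(G) ∩ {x_{(a,a)} = x_{(a,b)} : ab ∈ E(G) inside a branch
set}`; faces by equations and linear images are free (`HasEFOfSize.inter_eqs`,
`HasEFOfSize.image_linearMap`).
[cite: AboulkerEtAl2019, Obs. 5 with its proof (§2; arXiv:1806.00541 p0005 L12–18) and the folklore facts p0005 L3] -/
theorem hasEFOfSize_corPolytopeGraph_of_isMinor {α β : Type} [Fintype α] [DecidableEq α]
    [Fintype β] [DecidableEq β] (H : SimpleGraph α) (G : SimpleGraph β) [DecidableRel H.Adj]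
    [DecidableRel G.Adj] (hmin : IsMinor H G) (R : ℕ) (hG : HasEFOfSize (corPolytopeGraph G) R) :
    HasEFOfSize (corPolytopeGraph H) R := by
  classical
  obtain ⟨φ, hne, hconn, hadj⟩ := hmin
  -- (i) representative vertices of the branch sets
  choose ρ hρ using hne
  -- (iii) representative `G`-edges between the branch sets of the ends of the edges of `H`
  have hrep : ∀ p : α × α, ∃ e : β × β,
      H.Adj p.1 p.2 → φ e.1 = some p.1 ∧ φ e.2 = some p.2 ∧ G.Adj e.1 e.2 := by
    intro p
    by_cases h : H.Adj p.1 p.2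
    · obtain ⟨x, y, hx, hy, hxy⟩ := hadj p.1 p.2 h
      exact ⟨(x, y), fun _ => ⟨hx, hy, hxy⟩⟩
    · exact ⟨(ρ p.1, ρ p.2), fun h' => absurd h' h⟩
  choose q hq using hrep
  -- the projection `L`: representative coordinates, zero at the masked pairs of `H`
  let f : α × α → β × β := fun p => if p.1 = p.2 then (ρ p.1, ρ p.1) else q p
  let mask : α × α → ℝ := fun p => if p.1 = p.2 then 1 else if H.Adj p.1 p.2 then 1 else 0
  let L : (β × β → ℝ) →ₗ[ℝ] (α × α → ℝ) :=
    { toFun := fun z p => mask p * z (f p)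
      map_add' := fun z z' => by
        funext p
        simp only [Pi.add_apply]
        ring
      map_smul' := fun a z => by
        funext p
        simp only [Pi.smul_apply, smul_eq_mul, RingHom.id_apply]
        ring }
  have hL : ∀ z p, L z p = mask p * z (f p) := fun z p => rfl
  -- intra-branch-set edges (the contracted ones) and the face `F = COR(G) ∩ K`
  let intra : β × β → Prop := fun e => G.Adj e.1 e.2 ∧ φ e.1 = φ e.2 ∧ φ e.1 ≠ none
  let c : {e // intra e} → (β × β → ℝ) := fun t =>
    Pi.single (t.1.1, t.1.1) 1 - Pi.single (t.1.1, t.1.2) 1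
  have hc : ∀ (t : {e // intra e}) (z : β × β → ℝ),
      c t ⬝ᵥ z = z (t.1.1, t.1.1) - z (t.1.1, t.1.2) := by
    intro t z
    simp only [c, sub_dotProduct, single_dotProduct, one_mul]
  let K : Set (β × β → ℝ) := {z | ∀ t : {e // intra e}, c t ⬝ᵥ z = 0}
  -- generators on the face: the `s ∈ {0,1}^{V(G)}` constant on branch sets
  let good : (β → Bool) → Prop := fun s => ∀ t : {e // intra e}, c t ⬝ᵥ corVec G s = 0
  have good_iff : ∀ s, good s ↔
      ∀ x y, G.Adj x y → φ x = φ y → φ x ≠ none → s x = s y := by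
    intro s
    constructor
    · intro hs x y hxy hφ hnn
      have h1 : corVec G s (x, x) = corVec G s (x, y) := by
        have := hs ⟨(x, y), hxy, hφ, hnn⟩
        rw [hc] at this
        exact sub_eq_zero.1 this
      have h2 : corVec G s (y, y) = corVec G s (y, x) := by
        have := hs ⟨(y, x), hxy.symm, hφ.symm, fun h => hnn (hφ.trans h)⟩
        rw [hc] at this
        exact sub_eq_zero.1 this
      exact Bool.eq_iff_iff.2
        ⟨(corVec_diag_eq_adj_iff G s hxy).1.1 h1, (corVec_diag_eq_adj_iff G s hxy.symm).1.1 h2⟩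
    · rintro hs ⟨e, he, hφ, hnn⟩
      rw [hc]
      exact sub_eq_zero.2 ((corVec_diag_eq_adj_iff G s he).1.2
        fun h => (hs e.1 e.2 he hφ hnn).symm.trans h)
  -- along a walk inside a branch set a good `s` is constant
  have walk_const : ∀ s, good s → ∀ (x y : β) (p : G.Walk x y),
      (∀ z ∈ p.support, φ z = φ x) → φ x ≠ none → s x = s y := by
    intro s hs x y p
    induction p with
    | nil => intros; rfl
    | @cons a₁ a₂ a₃ had p ih =>
      intro hsupp hnn
      have h₂ : φ a₂ = φ a₁ := hsupp a₂ (by simp)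
      have e₁ : s a₁ = s a₂ := (good_iff s).1 hs a₁ a₂ had h₂.symm hnn
      have e₂ : s a₂ = s a₃ :=
        ih (fun z hz => (hsupp z (by simp [hz])).trans h₂.symm) (by rwa [h₂])
      exact e₁.trans e₂
  have branch_const : ∀ s, good s → ∀ (x x' : β) (u : α), φ x = some u → φ x' = some u →
      s x = s x' := by
    intro s hs x x' u hx hx'
    obtain ⟨p, hp⟩ := hconn x x' (by rw [hx, hx']) (by rw [hx]; exact Option.some_ne_none u)
    exact walk_const s hs x x' p hp (by rw [hx]; exact Option.some_ne_none u)
  -- lifting `s' ∈ {0,1}^{V(H)}` to `G` (unused vertices ↦ false)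
  let lift : (α → Bool) → (β → Bool) := fun s' x => (φ x).elim false s'
  have lift_apply : ∀ (s' : α → Bool) (x : β) (u : α), φ x = some u → lift s' x = s' u := by
    intro s' x u hx
    simp [lift, hx]
  have lift_good : ∀ s', good (lift s') := by
    intro s'
    rw [good_iff]
    intro x y _ hφ hnn
    obtain ⟨u, hu⟩ := Option.ne_none_iff_exists'.1 hnn
    rw [lift_apply s' x u hu, lift_apply s' y u (hφ ▸ hu)]
  -- descending a good generator of `COR(G)` along `L`
  have desc_comp : ∀ s, good s → L (corVec G s) = corVec H (fun u => s (ρ u)) := by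
    intro s hs
    funext p
    obtain ⟨u, v⟩ := p
    rw [hL]
    show (if u = v then (1 : ℝ) else if H.Adj u v then 1 else 0) *
        corVec G s (if u = v then (ρ u, ρ u) else q (u, v)) = corVec H (fun u => s (ρ u)) (u, v)
    by_cases huv : u = v
    · subst huv
      rw [if_pos rfl, if_pos rfl, one_mul, corVec_apply_diag, corVec_apply_diag]
    · rw [if_neg huv, if_neg huv]
      by_cases huv' : H.Adj u v
      · obtain ⟨hq₁, hq₂, hq₃⟩ := hq (u, v) huv'
        rw [if_pos huv', one_mul, corVec_apply_adj H _ huv',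
          show q (u, v) = ((q (u, v)).1, (q (u, v)).2) from rfl, corVec_apply_adj G s hq₃,
          branch_const s hs _ (ρ u) u hq₁ (hρ u), branch_const s hs _ (ρ v) v hq₂ (hρ v)]
      · rw [if_neg huv', zero_mul, corVec_apply_of_not_adj H _ huv huv']
  have lift_comp : ∀ s', L (corVec G (lift s')) = corVec H s' := by
    intro s'
    rw [desc_comp _ (lift_good s')]
    congr 1
    funext u
    exact lift_apply s' (ρ u) u (hρ u)
  -- the finite generator sets and the face
  set SG : Finset (β × β → ℝ) := Finset.univ.image (corVec G) with hSGdef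
  set SK : Finset (β × β → ℝ) := (Finset.univ.filter good).image (corVec G) with hSKdef
  have hSG : Set.range (corVec G) = ↑SG := by
    rw [hSGdef, Finset.coe_image, Finset.coe_univ, Set.image_univ]
  have hSK : {y | y ∈ SG ∧ ∀ t : {e // intra e}, c t ⬝ᵥ y = 0} = ↑SK := by
    ext y
    simp only [Set.mem_setOf_eq, hSGdef, hSKdef, Finset.coe_image, Finset.coe_filter,
      Finset.mem_image, Finset.mem_univ, true_and, Set.mem_image, Set.mem_setOf_eq]
    constructor
    · rintro ⟨⟨s, rfl⟩, hK⟩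
      exact ⟨s, hK, rfl⟩
    · rintro ⟨s, hs, rfl⟩
      exact ⟨⟨s, rfl⟩, hs⟩
  have hface : corPolytopeGraph G ∩ K = convexHull ℝ (↑SK : Set (β × β → ℝ)) := by
    rw [corPolytopeGraph, hSG, ← hSK]
    refine convexHull_inter_eq_of_valid SG c fun y hy t => ?_
    obtain ⟨s, _, rfl⟩ := Finset.mem_image.1 hy
    obtain ⟨e, he, -, -⟩ := t
    rw [hc]
    exact (corVec_diag_eq_adj_iff G s he).2
  -- `L` carries the face onto `COR(H)`
  have himage : corPolytopeGraph H = L '' (corPolytopeGraph G ∩ K) := by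
    rw [hface, LinearMap.image_convexHull, corPolytopeGraph]
    congr 1
    ext z
    simp only [Set.mem_range, Set.mem_image, Finset.mem_coe, hSKdef, Finset.mem_image,
      Finset.mem_filter, Finset.mem_univ, true_and]
    constructor
    · rintro ⟨s', rfl⟩
      exact ⟨corVec G (lift s'), ⟨lift s', lift_good s', rfl⟩, lift_comp s'⟩
    · rintro ⟨y, ⟨s, hs, rfl⟩, rfl⟩
      exact ⟨fun u => s (ρ u), (desc_comp s hs).symm⟩
  -- the face is free, the projection is free
  have hK : HasEFOfSize (corPolytopeGraph G ∩ K) R := hG.inter_eqs c fun _ => 0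
  rw [himage]
  exact hK.image_linearMap L

/-- **Observation 5, packaged** in the shape of `AvisTiwary2015_thm12` (`CutPolytopeMinorMonotone.lean`):
for finite simple graphs `H ≼ G`, every size of an extended formulation of `COR(G)` is a size of an
extended formulation of `COR(H)`, i.e. `xc(COR(H)) ≤ xc(COR(G))`.
[cite: AboulkerEtAl2019, Obs. 5 (§2; arXiv:1806.00541 p0005 L12–13)] -/
theorem AboulkerEtAl2019_obs5 :
    ∀ (α β : Type) [Fintype α] [DecidableEq α] [Fintype β] [DecidableEq β]
      (H : SimpleGraph α) (G : SimpleGraph β) [DecidableRel H.Adj] [DecidableRel G.Adj],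
      IsMinor H G → ∀ R : ℕ, HasEFOfSize (corPolytopeGraph G) R →
        HasEFOfSize (corPolytopeGraph H) R := by
  intro α β _ _ _ _ H G _ _ hmin R hG
  exact hasEFOfSize_corPolytopeGraph_of_isMinor H G hmin R hG

/-- **Lower bounds on `xc(COR)` ascend along minors** (contrapositive reading of Observation 5, the
form used in the proof of Theorem 6: "Since the extension complexity of the correlation polytope is
minor monotone … it suffices to show …" for the minor): if `H ≼ G` and `xc(COR(H)) ≥ B` then
`xc(COR(G)) ≥ B`.
[cite: AboulkerEtAl2019, Obs. 5 and proof of Thm. 6 (§2; arXiv:1806.00541 p0005 L12–13, L51)] -/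
theorem corPolytopeGraph_lowerBound_of_isMinor {α β : Type} [Fintype α] [DecidableEq α]
    [Fintype β] [DecidableEq β] (H : SimpleGraph α) (G : SimpleGraph β) [DecidableRel H.Adj]
    [DecidableRel G.Adj] (hmin : IsMinor H G) {B : ℝ}
    (hH : ∀ R : ℕ, HasEFOfSize (corPolytopeGraph H) R → B ≤ R) :
    ∀ R : ℕ, HasEFOfSize (corPolytopeGraph G) R → B ≤ R :=
  fun R hR => hH R (hasEFOfSize_corPolytopeGraph_of_isMinor H G hmin R hR)

/-- **The named fact `AboulkerEtAl2019_corGridMinor` is its grid instance.**  By Observation 5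
(proved above) the general-`G` statement "`G_{h,h} ≼ G ⇒ xc(COR(G)) ≥ 2^{ch}` for `h ≥ h₀`" of
`CorrelationPolytopeGridMinor.lean` is equivalent to the pure grid bound
"`xc(COR(G_{h,h})) ≥ 2^{ch}` for `h ≥ h₀`" (its proved corollary `AboulkerEtAl2019_corGridMinor.grid`).
This does NOT prove the fact; it isolates what is left of the printed proof of Theorem 6 (a face of
the `COR` of the grid with gadgets `≼ G_{t,t}` projecting onto `COR(K_{h,h}) ⊇ COR(K_h)`, and
Kaibel–Weltge `xc(COR(K_h)) ≥ 1.5^h`, p0005 L49 – p0006 L27).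
[cite: AboulkerEtAl2019, Obs. 5 (p0005 L12–13) with Thm. 6 and its proof (p0005 L41 – p0006 L27)] -/
theorem AboulkerEtAl2019_corGridMinor_iff_grid :
    AboulkerEtAl2019_corGridMinor ↔
      ∃ c : ℝ, 0 < c ∧ ∃ h₀ : ℕ, ∀ h : ℕ, h₀ ≤ h →
        ∀ R : ℕ, HasEFOfSize (corPolytopeGraph (gridGraph h)) R → (2 : ℝ) ^ (c * h) ≤ R := by
  constructor
  · exact AboulkerEtAl2019_corGridMinor.grid
  · rintro ⟨c, hc, h₀, hgrid⟩
    refine ⟨c, hc, h₀, ?_⟩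
    intro h hh V _ _ G _ hmin R hR
    exact hgrid h hh R (hasEFOfSize_corPolytopeGraph_of_isMinor (gridGraph h) G hmin R hR)

end Literature.Combinatorics.Optimization

end
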